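import Mathlib
import Summits.NavierStokesRegularity.NavierStokesRegularity.Theorems.TypeIQuarterGateScarEnvelopeTypeISatelliteTowerGalleryCompactness

/-!
# Sequential compactness of the A–B class under a uniform `𝐈` bound (with persistence)

A sequence `(U k, P k, H k)` of A–B objects of rate `M` (`ABTower M`) with ONE bound
`𝐈(U k) ≤ I < ∞` has a subsequence converging in `L³(Q_R(0))` for every `R > 0` to an A–B object
`(U', P', H')` of rate `M` with `𝐈(U') ≤ 4 I`, `U' ∈ L³(Q_R(0))`; and a final-time point at which the
`U (σ j)` are frequently singular is a singular point of `U'` (persistence, A–B Prop. 2.3).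

This is the tree compactness theorem `SliceBudget.local_typeI_compactness_twin_inBall` read on
the class `ABTower M` itself (no zooming): the companion of `abTower_galleryCompact` (module
`…SatelliteTowerGalleryCompactness`) needed whenever a sequence of gallery limits — each an A–B
object with `𝐈 ≤ 4·𝐈(U)` — has to be taken to the limit together with its scars (minimising
sequences for the gallery-wise minimal singular rate, ω-limit sets of the root-zoom semiflow in the
crux idea `Cruxes/ScarEnvelopeTypeI/Ideas/zoom-recurrence.md`, ns-idea-17 g0).  Inside ONE gallery
the hypothesis `𝐈 ≤ I` is free (`I = 4·𝐈(U)`); across the whole class `ABTower M` it is the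
instrument obstacle (M𝐈₁) of nsreg-p3 ROUND-35 and is NOT claimed.

HONEST FRAMING: compactness TOOLING about hypothetical Type-I ancient objects for the crux
`TypeIQuarterGate.ScarEnvelopeTypeI` (item 23843); nothing open is proved — 23843,
`∀ M, ¬ OneScarLeaf M`, `∀ M, ¬ InfiniteDescent M`, the route and Navier–Stokes regularity are OPEN.
LEAD-lineage prover ns-sz-p1 g6; `--supports stmt-NavierStokesRegularity-23843 --as helper`.
-/

-- the summit-side namespace repeats a component by design (single-conjunct summit, D-0017)
set_option linter.dupNamespace false

open MeasureTheory Set Metric Filter Topology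
open scoped ENNReal

namespace Summit.NavierStokesRegularity.NavierStokesRegularity.Cruxes.ScarEnvelopeTypeI.ZoomDictionary

section GallerySeq

open Literature.Analysis.FluidPDE

/-- **Sequential compactness of `ABTower M` under a uniform `𝐈` bound, with persistence.** -/
theorem abTower_seqCompact {M : ℝ} {I : ℝ≥0∞} (hI : I < ⊤)
    (Us : ℕ → ℝ → (EuclideanSpace ℝ (Fin 3)) → (EuclideanSpace ℝ (Fin 3)))
    (Ps : ℕ → ℝ → (EuclideanSpace ℝ (Fin 3)) → ℝ)
    (Hs : ℕ → ℝ → (EuclideanSpace ℝ (Fin 3)) → (EuclideanSpace ℝ (Fin 3)) →L[ℝ] (EuclideanSpace ℝ (Fin 3)))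
    (hAB : ∀ k, ABTower M (Us k) (Ps k) (Hs k))
    (hIk : ∀ k, typeIBound (Iio (0 : ℝ) ×ˢ univ) (Us k) (Ps k) (Hs k) ≤ I) :
    ∃ (U' : ℝ → (EuclideanSpace ℝ (Fin 3)) → (EuclideanSpace ℝ (Fin 3))) (P' : ℝ → (EuclideanSpace ℝ (Fin 3)) → ℝ)
      (H' : ℝ → (EuclideanSpace ℝ (Fin 3)) → (EuclideanSpace ℝ (Fin 3)) →L[ℝ] (EuclideanSpace ℝ (Fin 3)))
      (σ : ℕ → ℕ), StrictMono σ ∧ ABTower M U' P' H' ∧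
      typeIBound (Iio (0 : ℝ) ×ˢ univ) U' P' H' ≤ 4 * I ∧
      (∀ R : ℝ, 0 < R → MemLp (Function.uncurry U') 3
        (volume.restrict (parabolicCylinder R (0 : ℝ × (EuclideanSpace ℝ (Fin 3)))))) ∧
      (∀ R : ℝ, 0 < R → Tendsto (fun j => eLpNorm
        (Function.uncurry (Us (σ j)) - Function.uncurry U') 3
        (volume.restrict (parabolicCylinder R (0 : ℝ × (EuclideanSpace ℝ (Fin 3)))))) atTop (𝓝 0)) ∧
      (∀ y : (EuclideanSpace ℝ (Fin 3)),
        (∃ᶠ j in atTop, ¬ RegPt (Us (σ j)) y) → ¬ RegPt U' y) := by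
  have hdec : ∀ k, HasTypeITimeDecay M (Us k) := fun k => (hAB k).1.2.2.2
  have hM : 0 ≤ M := by
    have h := hdec 0 (-1) (by norm_num) 0
    rw [neg_neg, Real.sqrt_one, div_one] at h
    exact (norm_nonneg _).trans h
  have hcc_pos : ∀ m : ℕ, (0 : ℝ) < (2 : ℝ) ^ m := fun m => by positivity
  have hQsl : ∀ ρ : ℝ, (parabolicCylinderOpens ρ (0 : ℝ × (EuclideanSpace ℝ (Fin 3))) :
      TopologicalSpace.Opens (ℝ × (EuclideanSpace ℝ (Fin 3)))) ≤
      slab (EuclideanSpace ℝ (Fin 3)) (Iio 0) isOpen_Iio := fun ρ w hw =>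
    parabolicCylinder_origin_subset_slab ρ hw
  -- the class on every `Q(0, 2ᵐ)`, the weak gradients, the Type I bound
  have hballs : ∀ m k : ℕ, IsSuitableWeakSolutionInBall ((2 : ℝ) ^ m) 0 (Us k) (Ps k) :=
    fun m k => (hAB k).2.1 _ (hcc_pos m)
  have hgrads : ∀ m k : ℕ,
      HasWeakSpatialGradientOn (parabolicCylinderOpens ((2 : ℝ) ^ m) (0 : ℝ × (EuclideanSpace ℝ (Fin 3))))
        (Us k) (Hs k) := fun m k => (hAB k).2.2.1.mono (hQsl _)
  have hIs : ∀ m k : ℕ,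
      typeIBound (parabolicCylinder ((2 : ℝ) ^ m) (0 : ℝ × (EuclideanSpace ℝ (Fin 3)))) (Us k) (Ps k) (Hs k) ≤ I :=
    fun m k => (typeIBound_mono (parabolicCylinder_origin_subset_slab _)).trans (hIk k)
  -- ## compactness with the class on all balls (tree)
  obtain ⟨Ut, Pt, Ht, σ, hσ, hIBU, hswU, hHU, h4I, hmemU, hconvU, hpers⟩ :=
    Summit.NavierStokesRegularity.NavierStokesRegularity.Cruxes.ScarEnvelopeTypeI.SliceBudget.local_typeI_compactness_twin_inBall
      I Us Ps Hs hI (fun m k _ => hballs m k) (fun m k _ => hgrads m k) (fun m k _ => hIs m k)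
  have h4Itop : typeIBound (Iio (0 : ℝ) ×ˢ univ) Ut Pt Ht < ⊤ :=
    lt_of_le_of_lt h4I (ENNReal.mul_lt_top (by simp) hI)
  -- ## the rate: on the sequence everywhere, on the limit a.e.
  have hrate_ae : ∀ᵐ w ∂(volume.restrict (Iio (0 : ℝ) ×ˢ (univ : Set (EuclideanSpace ℝ (Fin 3))))),
      ‖Ut w.1 w.2‖ ≤ M / Real.sqrt (-w.1) := by
    have hQ : ∀ m : ℕ, ∀ᵐ w ∂(volume.restrict (parabolicCylinder ((2 : ℝ) ^ m) (0 : ℝ × (EuclideanSpace ℝ (Fin 3))))),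
        ‖Ut w.1 w.2‖ ≤ M / Real.sqrt (-w.1) := by
      intro m
      have hmeas : ∀ j, AEStronglyMeasurable (Function.uncurry (Us (σ j)))
          (volume.restrict (parabolicCylinder ((2 : ℝ) ^ m) (0 : ℝ × (EuclideanSpace ℝ (Fin 3))))) := fun j =>
        (hballs m (σ j)).1.distributional.1.aestronglyMeasurable
      obtain ⟨ψ, -, hae⟩ := exists_subseq_tendsto_ae₃ hmeas (hmemU _ (hcc_pos m)).1
        (hconvU _ (hcc_pos m))
      filter_upwards [hae, ae_restrict_mem (isOpen_parabolicCylinder _ _).measurableSet]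
        with w hw hwmem
      refine le_of_tendsto hw.norm (Eventually.of_forall fun i => ?_)
      have hw0 : w.1 < 0 := by
        have h1 := ((mem_parabolicCylinder).1 hwmem).1.2
        simpa using h1
      exact hdec _ w.1 hw0 w.2
    have hcover : (Iio (0 : ℝ) ×ˢ (univ : Set (EuclideanSpace ℝ (Fin 3)))) ⊆
        ⋃ m : ℕ, parabolicCylinder ((2 : ℝ) ^ m) (0 : ℝ × (EuclideanSpace ℝ (Fin 3))) := by
      rintro ⟨t, x'⟩ ⟨ht', -⟩
      obtain ⟨m, hm⟩ := exists_mem_parabolicCylinder_two_pow₃ (mem_Iio.1 ht') x'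
      exact mem_iUnion.2 ⟨m, hm⟩
    exact ae_restrict_of_ae_restrict_of_subset hcover ((ae_restrict_iUnion_iff _ _).2 hQ)
  -- ## representatives: the rate everywhere, then continuous Oseen-mild (KNSS)
  obtain ⟨U₁, hae₁, hdec₁⟩ := exists_repr_hasTypeITimeDecay hM hrate_ae
  have hae₁' : ∀ᵐ w ∂(volume.restrict ((slab (EuclideanSpace ℝ (Fin 3)) (Iio 0) isOpen_Iio :
      TopologicalSpace.Opens (ℝ × (EuclideanSpace ℝ (Fin 3)))) : Set (ℝ × (EuclideanSpace ℝ (Fin 3))))),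
      Function.uncurry Ut w = Function.uncurry U₁ w := by
    rw [coe_slab]
    exact hae₁
  have hsw₁ : IsSuitableWeakSolutionOn (slab (EuclideanSpace ℝ (Fin 3)) (Iio 0) isOpen_Iio) 1 0 U₁ Pt :=
    hswU.congr_ae hae₁' (ae_of_all _ fun _ => rfl)
  have hI₁ : typeIBound (Iio (0 : ℝ) ×ˢ univ) U₁ Pt Ht < ⊤ := by
    rwa [← typeIBound_congr_ae hae₁]
  obtain ⟨U', hae₂, hUc, hUdiv, hUmild, hUrate⟩ :=
    exists_oseenMild_repr_of_typeIBound_lt_top hsw₁ hdec₁ hI₁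
  have hae : ∀ᵐ w ∂(volume.restrict (Iio (0 : ℝ) ×ˢ (univ : Set (EuclideanSpace ℝ (Fin 3))))),
      Function.uncurry Ut w = Function.uncurry U' w := by
    filter_upwards [hae₁, hae₂] with w h1 h2
    rw [h1, h2]
  have hae' : ∀ᵐ w ∂(volume.restrict ((slab (EuclideanSpace ℝ (Fin 3)) (Iio 0) isOpen_Iio :
      TopologicalSpace.Opens (ℝ × (EuclideanSpace ℝ (Fin 3)))) : Set (ℝ × (EuclideanSpace ℝ (Fin 3))))),
      Function.uncurry Ut w = Function.uncurry U' w := by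
    rw [coe_slab]
    exact hae
  have hTI : IsTypeIAncientMild M U' :=
    LocalTypeIBlowup.isTypeIAncientMild_of_continuous_oseenMild_rate hUc hUdiv hUmild hUrate
  have hIBU' : ∀ a : ℝ, 0 < a → IsSuitableWeakSolutionInBall a (0 : ℝ × (EuclideanSpace ℝ (Fin 3))) U' Pt :=
    fun a ha => (hIBU a ha).congr_ae'
      (ae_restrict_of_ae_restrict_of_subset (parabolicCylinder_origin_subset_slab a) hae)
      (ae_of_all _ fun _ => rfl)
  have hHU' : HasWeakSpatialGradientOn (slab (EuclideanSpace ℝ (Fin 3)) (Iio 0) isOpen_Iio) U' Ht :=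
    hHU.congr_ae hae'
  have hIeq : typeIBound (Iio (0 : ℝ) ×ˢ univ) U' Pt Ht = typeIBound (Iio (0 : ℝ) ×ˢ univ) Ut Pt Ht := by
    rw [← typeIBound_congr_ae hae]
  have hIU' : typeIBound (Iio (0 : ℝ) ×ˢ univ) U' Pt Ht < ⊤ := by
    rw [hIeq]
    exact h4Itop
  refine ⟨U', Pt, Ht, σ, hσ, ⟨hTI, hIBU', hHU', hIU'⟩, ?_, fun R hR => ?_, fun R hR => ?_,
    fun y hy => ?_⟩
  · rw [hIeq]
    exact h4I
  · exact (hmemU R hR).ae_eq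
      (ae_restrict_of_ae_restrict_of_subset (parabolicCylinder_origin_subset_slab R) hae)
  · have haeR : ∀ᵐ w ∂(volume.restrict (parabolicCylinder R (0 : ℝ × (EuclideanSpace ℝ (Fin 3))))),
        Function.uncurry Ut w = Function.uncurry U' w :=
      ae_restrict_of_ae_restrict_of_subset (parabolicCylinder_origin_subset_slab R) hae
    refine (hconvU R hR).congr' (Eventually.of_forall fun j => ?_)
    exact eLpNorm_congr_ae (haeR.mono fun w hw => by simp only [Pi.sub_apply, hw])
  · set zy : ℝ × (EuclideanSpace ℝ (Fin 3)) := ((0 : ℝ), y) with hzydef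
    have hlimsup : ∀ R ∈ Ioo (0 : ℝ) 1, limsup (fun j => eLpNorm (Function.uncurry (Us (σ j))) ⊤
        (volume.restrict (parabolicCylinder R zy))) atTop = ⊤ := by
      intro R hR
      refine top_le_iff.1 (le_limsup_of_frequently_le ?_)
      refine hy.mono fun j hj => ?_
      exact (eLpNorm_top_eq_top_of_not_regPt hj hR.1).ge
    have hsing : IsBackwardSingularPoint Ut zy := hpers zy (by rw [hzydef]) hlimsup
    have h1 : ¬ RegPt Ut y := not_regPt_of_isBackwardSingularPoint hsing
    rintro ⟨r, hr, M', hM'⟩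
    apply h1
    refine ⟨r, hr, M', ?_⟩
    have haer : ∀ᵐ w ∂(volume.restrict (parabolicCylinder r (((0 : ℝ), y) : ℝ × (EuclideanSpace ℝ (Fin 3))))),
        Function.uncurry Ut w = Function.uncurry U' w :=
      ae_restrict_of_ae_restrict_of_subset (parabolicCylinder_subset_lowerHalf r y) hae
    filter_upwards [hM', haer] with w hw hw'
    have e : Ut w.1 w.2 = U' w.1 w.2 := hw'
    rw [e]
    exact hw

end GallerySeq

end Summit.NavierStokesRegularity.NavierStokesRegularity.Cruxes.ScarEnvelopeTypeI.ZoomDictionary
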